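import Literature.Probability.Percolation.CharLengthEquivalence
import Literature.Probability.Percolation.NearCriticalRSWStart
import HarnessLib

/-!
# Nolin's Cor. 41 and Lemma 39 after the unconditional start: small `ε` outright, every `ε` from three leaves (proofs only)

Topic `Literature/Probability/Percolation`; family `crit-perc`. Proof-only sequel of
`NearCriticalScalingProofs.lean` and `CharLengthEquivalence.lean` for the named facts
`Nolin2008_cor41` (`NearCriticalScaling.lean`; Nolin 2008, §7.4, Cor. 41 [arXiv 0711.4948:
Cor. 39]: "`θ(p) = P_p(0 ⇝ ∞) ≍ P_p(0 ⇝ ∂S_{L(p)})` uniformly in `p > 1/2`", `L(p) = L_ε(p)` for a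
fixed `ε ∈ (0, 1/2)`) and `Nolin2008_lemma39` (`NearCriticalArm.lean`; Lemma 39 with Remark 40
[arXiv: Lemma 37, Remark 38], the uniform exponential decay above `L_ε(p)`). No new definition, no
new named fact.

## What changed

Both reductions of the tree for these two facts at EVERY `ε ∈ (0, 1/2)` —
`Nolin2008_cor41_of_prop34` (`CharLengthEquivalence.lean`: `Nolin2008_RSW_one`, `Nolin2008_prop34`,
`Werner2009_fourArm_quasiMult`, `Werner2009_fourArm_lowerBound`) and `Nolin2008_cor41_of_leavesW`
(`NearCriticalArmProofs.lean`: `Werner2009_lemma62`, `Werner2009_lemma62W` and the two four-arm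
facts) — used a Russo–Seymour–Welsh input at general `p` (the "moreover" clause
`Nolin2008_RSW_one`, resp. Werner's easy-way pivotal count `Werner2009_lemma62W`) for exactly one
purpose: the START of Nolin's block argument (proof of Lemma 39: "The RSW theory thus entails
(Theorem 2) that for all fixed `ε₁ > 0`, we can take `ε₀` sufficiently small to get automatically
(and independently of `p`) that `P_p(𝒞_H([0, L(p)] × [0, 2L(p)])) ≤ ε₁`"). That start is now a
THEOREM of the tree: `Nolin2008_lemma39_at_holds_small` (`NearCriticalRSWStart.lean`, from the
two-scale Russo–Seymour–Welsh bounds of Bollobás–Riordan, Ch. 3, Lemma 4 / Cor. 5, iterated in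
lattice hexagons, `TriRSWRounds.lean`) proves `Nolin2008_lemma39_at ε` for every `ε ≤ ε₀`
unconditionally. This file draws the consequences for Cor. 41 and Lemma 39:

* `Nolin2008_lemma39_small_holds` — the decay for all `0 < ε ≤ ε₀`, in the shape (`ε < p < 1/2`,
  `n ≥ 1`) of `Nolin2008_lemma39_small` / `Nolin2008_lemma39`, now unconditional;
* `Nolin2008_cor41_at_holds_small` — **Cor. 41 PROVED at every `0 < ε ≤ ε₀`**: there are
  `δ, c > 0` with `c · P_p(0 ↔ ∂Λ_{L_ε(p)}) ≤ θ(p)` for `1/2 < p < 1/2 + δ` (this is Cor. 41 as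
  Nolin proves it before the last sentence of the proof of Lemma 39, i.e. for the `ε` "given by
  RSW"; the ladder `Nolin2008_cor41_at_of_ladder`, RSW at `1/2` `tri_rsw_half_holds`);
* `Nolin2008_lemma39_of_lengths`, `Nolin2008_cor41_of_lengths` — for every `ε ∈ (0, 1/2)` the two
  facts follow from the single remaining input, the non-trivial inequality
  `L_{ε₀}(p) ≤ C L_ε(p)` (`0 < ε₀ < ε < 1/2`, `p` just below `1/2`) of Nolin's Cor. 37
  [arXiv: Cor. 35] ("The result for any `ε ∈ (0, 1/2)` follows readily by using the equivalence of
  lengths for different values of `ε`"), through `Nolin2008_lemma39_of_small_of_lengths`;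
* `Nolin2008_cor41_of_scaling` — hence `Nolin2008_cor41` from Kesten's relation `Nolin2008_prop34`
  and the two CRITICAL four-arm inputs of the printed proof of Cor. 37
  (`Werner2009_fourArm_quasiMult`, `Werner2009_fourArm_lowerBound`, used at `t = 1/2` only, through
  `charLength_lengths_of_prop34`; the companion statement for Lemma 39 is the tree's
  `Nolin2008_lemma39_of_scaling`, `NearCriticalCorrelationLengthProofs.lean`), and
  `Nolin2008_lemma39_of_lemma62`, `Nolin2008_cor41_of_lemma62` — both facts from the three named
  facts `Werner2009_lemma62` (whence `Nolin2008_prop34`, `Nolin2008_prop34_of_expDecay` with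
  `BollobasRiordan2006_tri_expDecay_holds`), `Werner2009_fourArm_quasiMult`,
  `Werner2009_fourArm_lowerBound`. The discharge `Nolin2008_cor41_holds` is
  `Nolin2008_cor41_of_lemma62` applied to their three `_holds`; no Russo–Seymour–Welsh statement at
  `p ≠ 1/2` remains among the leaves (compare `Nolin2008_cor41_of_prop34`, four leaves including
  `Nolin2008_RSW_one`, and `Nolin2008_cor41_of_leavesW`, four leaves including
  `Werner2009_lemma62W`);
* `Nolin2008_theta_asymp_of_scaling`, `Nolin2008_theta_asymp_of_leaves₆` — the same substitution
  in `Nolin2008_theta_asymp_of_prop34` / `_of_lemma62` (`θ(p) ≍ π₁(L_ε(p))` for every `ε`);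
* `triTheta_exponent_of_leaves4`, `triTheta_exponent_of_prop34` — **crit-perc.S16 from four named
  facts**: `θ(p) = (p - 1/2)^{5/36 + o(1)}` (Smirnov–Werner 2001, Thm. 1 (i); Kesten 1987) from
  `oneArm_exponent`, `fourArm_exponent`, `Werner2009_lemma62` (or `Nolin2008_prop34`) and
  `Nolin2008_thm27_oneArm` — the tree's `triTheta_exponent_of_leaves5` (`NearCriticalRSW.lean`) with
  its fifth leaf `Nolin2008_RSW_one` removed (equivalently `triTheta_exponent_of_nearCritical`,
  `NearCriticalScaling.lean`, without its leaf `Nolin2008_cor41`), at `ε = min ε₀ (1/4)`.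

## References

* P. Nolin, Near-critical percolation in two dimensions, *Electron. J. Probab.* 13 (2008)
  1562–1623, §7.3 Cor. 37, §7.4 Lemma 39, Remark 40, Cor. 41 and eq. (7.25) (arXiv 0711.4948:
  Cor. 35, Lemma 37, Remark 38, Cor. 39, pp. 26–27) [Nolin2008].
* S. Smirnov, W. Werner, Critical exponents for two-dimensional percolation, *Math. Res. Lett.* 8
  (2001), §2, Thm. 1 and the paragraph following it [SmirnovWernerMRL2001].
* W. Werner, Lectures on two-dimensional critical percolation, PCMI (2009), Lecture 6, §1,
  Lemma 6.2, "End of the proof of the theorem" [WernerPCMI2009].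
* B. Bollobás, O. Riordan, *Percolation*, CUP (2006), Ch. 3, Lemma 4, Cor. 5 [BollobasRiordan2006].
* H. Kesten, Scaling relations for 2D-percolation, *Comm. Math. Phys.* 109 (1987) [KestenScalingCMP1987].

Tree: `Nolin2008_lemma39_at_holds_small` (`NearCriticalRSWStart.lean`), `one_le_charLength`,
`Nolin2008_subcritical_crossing_holds`, `Nolin2008_theta_asymp_at_of_nearCritical`
(`NearCriticalRSW.lean`), `Nolin2008_cor41_at_of_ladder`, `Nolin2008_cor41_of_ladder`
(`NearCriticalArm.lean`), `tri_rsw_half_holds` (`TriThetaHalf.lean`),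
`Nolin2008_lemma39_of_small_of_lengths` (`NearCriticalScalingProofs.lean`),
`charLength_lengths_of_prop34`, `Nolin2008_theta_asymp_of_facts` (`CharLengthEquivalence.lean`,
`KestenScalingThetaProofs.lean`), `Nolin2008_prop34_of_expDecay` (`KestenRelationRussoProofs.lean`),
`BollobasRiordan2006_tri_expDecay_holds` (`TriSubcriticalCrossingProofs.lean`),
`triTheta_exponent_of_scaling_at` (`KestenScaling.lean`). Mathlib: nothing beyond the imports.
-/

noncomputable section

open MeasureTheory Set Filter Topology
open scoped unitInterval

namespace Literature.Probability.Percolation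

open LatticeModels

/-! ### Lemma 39 and Cor. 41 at every small `ε`, unconditionally -/

/-- **Uniform exponential decay above `L_ε(p)` for every small `ε`, unconditionally** (Nolin
2008, §7.4, Lemma 39 with Remark 40 [arXiv 0711.4948: Lemma 37, Remark 38], "for any `ε` below
some fixed value `ε₀`"): there is `ε₀ > 0` such that for every `0 < ε ≤ ε₀` and `k ≥ 1` there are
`C₁, C₂ > 0` with `P_p(LR(n, k n)) ≤ C₁ e^{-C₂ n / L_ε(p)}` for all `ε < p < 1/2` and `n ≥ 1` — the
conclusion of `Nolin2008_lemma39_small` (`NearCriticalRSW.lean`) without its hypothesis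
`Nolin2008_RSW_one`: the tree's `Nolin2008_lemma39_at_holds_small` (`NearCriticalRSWStart.lean`),
whose guard `1 ≤ L_ε(p)` holds for `ε < p < 1/2` (`one_le_charLength`). [cite: Nolin2008, §7.4, Lemma 39 and Remark 40 (arXiv 0711.4948: Lemma 37, Remark 38)] -/
theorem Nolin2008_lemma39_small_holds :
    ∃ ε₀ > (0 : ℝ), ∀ ⦃ε : ℝ⦄, 0 < ε → ε ≤ ε₀ → ∀ k : ℕ, 1 ≤ k →
      ∃ C₁ > (0 : ℝ), ∃ C₂ > (0 : ℝ), ∀ p : unitInterval, ε < (p : ℝ) → (p : ℝ) < 1 / 2 →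
        ∀ n : ℕ, 1 ≤ n →
          triLRCrossingProb p n (k * n) ≤ C₁ * Real.exp (-(C₂ * n / charLength ε p)) := by
  obtain ⟨ε₀, hε₀, h⟩ := Nolin2008_lemma39_at_holds_small
  refine ⟨ε₀, hε₀, fun ε hε hεle k hk => ?_⟩
  obtain ⟨C₁, hC₁, C₂, hC₂, hb⟩ := h ε hεle k hk
  exact ⟨C₁, hC₁, C₂, hC₂, fun p hεp hp n _ =>
    hb p hp (one_le_charLength Nolin2008_subcritical_crossing_holds hε hεp hp) n⟩

/-- **Cor. 41 at every small `ε`, proved** (Nolin 2008, §7.4, Cor. 41 [arXiv 0711.4948: Cor. 39]: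
"`θ(p) = P_p(0 ⇝ ∞) ≍ P_p(0 ⇝ ∂S_{L(p)})` uniformly in `p > 1/2`", proof: "overlapping
parallelograms …, each parallelogram twice larger than the previous one, so that the `k`-th of them
has a probability at least `1 - C₁ e^{-C₂ 2^k}` to present a crossing in the 'hard' direction …
Since `∏_k (1 - C₁ e^{-C₂ 2^k}) > 0`, we are done"; only the non-trivial inequality is recorded, as
in `Nolin2008_cor41`). There is `ε₀ > 0` such that for every `0 < ε ≤ ε₀`, `ε < 1/2`, there are
`δ, c > 0` with `c · P_p(0 ↔ ∂Λ_{L_ε(p)}) ≤ θ(p)` for `1/2 < p < 1/2 + δ`: the ladder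
`Nolin2008_cor41_at_of_ladder` (RSW at `1/2`, `tri_rsw_half_holds`; Harris–FKG) fed with the
unconditional decay `Nolin2008_lemma39_small_holds` for the aspect ratios `4` and `2`. This is the
body of the named fact `Nolin2008_cor41` for these `ε`; the remaining `ε ∈ (ε₀, 1/2)` need Nolin's
Cor. 37 (`Nolin2008_cor41_of_lengths`). [cite: Nolin2008, §7.4, Cor. 41 (arXiv 0711.4948: Cor. 39)] [cite: WernerPCMI2009, Lecture 6, §1 (display: θ(p) ≥ c₃ P_p(0 ↔ ∂Λ_{L(p)}))] -/
theorem Nolin2008_cor41_at_holds_small :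
    ∃ ε₀ > (0 : ℝ), ∀ ⦃ε : ℝ⦄, 0 < ε → ε ≤ ε₀ → ε < 1 / 2 →
      ∃ δ > (0 : ℝ), ∃ c > (0 : ℝ),
        ∀ p : unitInterval, 1 / 2 < (p : ℝ) → (p : ℝ) < 1 / 2 + δ →
          c * (triSitePercolation p).real (triOneArm (charLength ε p)) ≤ triTheta p := by
  obtain ⟨ε₀, hε₀, h39⟩ := Nolin2008_lemma39_small_holds
  refine ⟨ε₀, hε₀, fun ε hε hεle hε' => ?_⟩
  exact Nolin2008_cor41_at_of_ladder hε hε' tri_rsw_half_holds (h39 hε hεle 4 (by norm_num))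
    (h39 hε hεle 2 (by norm_num)) Nolin2008_subcritical_crossing_holds

/-! ### Every `ε ∈ (0, 1/2)` from the equivalence of lengths alone -/

/-- **Lemma 39 for every `ε ∈ (0, 1/2)` from the equivalence of lengths alone** (Nolin 2008,
proof of Lemma 39, last paragraph: "Hence, we have proved the property for any `ε` below some
fixed value `ε₀` (given by RSW). The result for any `ε ∈ (0, 1/2)` follows readily by using the
equivalence of lengths for different values of `ε` (Corollary 37)"): if for all
`0 < ε₀ < ε < 1/2` there are `δ > 0` and `C` with `L_{ε₀}(p) ≤ C · L_ε(p)` for `1/2 - δ < p < 1/2`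
(the non-trivial inequality of Cor. 37 [arXiv: Cor. 35]), then `Nolin2008_lemma39` holds — by
`Nolin2008_lemma39_of_small_of_lengths` from the unconditional `Nolin2008_lemma39_small_holds`. [cite: Nolin2008, §7.4, Lemma 39 and Remark 40, with §7.3 Cor. 37 (arXiv 0711.4948: Lemma 37, Remark 38, Cor. 35)] -/
theorem Nolin2008_lemma39_of_lengths
    (hlen : ∀ ⦃ε₀ ε : ℝ⦄, 0 < ε₀ → ε₀ < ε → ε < 1 / 2 →
      ∃ δ > (0 : ℝ), ∃ C : ℝ, ∀ p : unitInterval, 1 / 2 - δ < (p : ℝ) → (p : ℝ) < 1 / 2 →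
        (charLength ε₀ p : ℝ) ≤ C * charLength ε p) :
    Nolin2008_lemma39 := by
  obtain ⟨ε₀, hε₀, hsmall⟩ := Nolin2008_lemma39_small_holds
  exact Nolin2008_lemma39_of_small_of_lengths hε₀ hsmall fun ε h h' => hlen hε₀ h h'

/-- **Cor. 41 for every `ε ∈ (0, 1/2)` from the equivalence of lengths alone** (Nolin 2008, §7.4,
Cor. 41 [arXiv 0711.4948: Cor. 39], through Lemma 39 / Remark 40 at every `ε`): under the same
single hypothesis `L_{ε₀}(p) ≤ C · L_ε(p)` (`0 < ε₀ < ε < 1/2`, `p` just below `1/2`) the named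
fact `Nolin2008_cor41` holds (`Nolin2008_cor41_of_ladder` with `tri_rsw_half_holds`,
`Nolin2008_lemma39_of_lengths`, `Nolin2008_subcritical_crossing_holds`). [cite: Nolin2008, §7.4, Cor. 41 with §7.3 Cor. 37 (arXiv 0711.4948: Cor. 39, Cor. 35)] -/
theorem Nolin2008_cor41_of_lengths
    (hlen : ∀ ⦃ε₀ ε : ℝ⦄, 0 < ε₀ → ε₀ < ε → ε < 1 / 2 →
      ∃ δ > (0 : ℝ), ∃ C : ℝ, ∀ p : unitInterval, 1 / 2 - δ < (p : ℝ) → (p : ℝ) < 1 / 2 →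
        (charLength ε₀ p : ℝ) ≤ C * charLength ε p) :
    Nolin2008_cor41 :=
  Nolin2008_cor41_of_ladder tri_rsw_half_holds (Nolin2008_lemma39_of_lengths hlen)
    Nolin2008_subcritical_crossing_holds

/-! ### Every `ε ∈ (0, 1/2)` from Kesten's relation and the two critical four-arm inputs -/

/-- **Cor. 41 for every `ε` from Kesten's relation and the two four-arm facts** (Nolin 2008,
§7.4, Cor. 41 through Lemma 39 and Cor. 37, whose printed proof uses `|p - 1/2| L_ε² π₄(L_ε) ≍ 1`,
quasi-multiplicativity and `π₄(L_{ε'}, L_ε) ≥ C₃ (L_{ε'}/L_ε)^{2-α'}`): `Nolin2008_prop34`,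
`Werner2009_fourArm_quasiMult` and `Werner2009_fourArm_lowerBound` (the latter two at `t = 1/2`
only, `charLength_lengths_of_prop34`) imply `Nolin2008_cor41`; no RSW input at `p ≠ 1/2` (compare
`Nolin2008_cor41_of_prop34`, which also assumed `Nolin2008_RSW_one`; the statement for Lemma 39 is
the tree's `Nolin2008_lemma39_of_scaling`). [cite: Nolin2008, §7.4, Cor. 41 with §7.3 Cor. 37 and Prop. 34 (arXiv 0711.4948: Cor. 39, Cor. 35, Prop. 32)] -/
theorem Nolin2008_cor41_of_scaling (hK : Nolin2008_prop34) (hQM : Werner2009_fourArm_quasiMult)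
    (hLB : Werner2009_fourArm_lowerBound) : Nolin2008_cor41 :=
  Nolin2008_cor41_of_lengths (charLength_lengths_of_prop34 hK hQM hLB)

/-- **Lemma 39 for every `ε` from three leaves**: the pivotal count below `L(p)`
(`Werner2009_lemma62`, whence Kesten's relation by `Nolin2008_prop34_of_expDecay` and the proved
sub-critical decay `BollobasRiordan2006_tri_expDecay_holds`) and the two critical four-arm facts
(`Nolin2008_lemma39_of_lengths`, `charLength_lengths_of_prop34`). [cite: Nolin2008, §7.4, Lemma 39 and Remark 40, with §7.3 Cor. 37 (arXiv 0711.4948: Lemma 37, Remark 38, Cor. 35)] [cite: WernerPCMI2009, Lecture 6, Lemma 6.2 and Cor. 6.3] -/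
theorem Nolin2008_lemma39_of_lemma62 (h62 : Werner2009_lemma62) (hQM : Werner2009_fourArm_quasiMult)
    (hLB : Werner2009_fourArm_lowerBound) : Nolin2008_lemma39 :=
  Nolin2008_lemma39_of_lengths (charLength_lengths_of_prop34
    (Nolin2008_prop34_of_expDecay BollobasRiordan2006_tri_expDecay_holds h62) hQM hLB)

/-- **Cor. 41 for every `ε` from three leaves** — the current leaves of the named fact
`Nolin2008_cor41`: `Werner2009_lemma62`, `Werner2009_fourArm_quasiMult`,
`Werner2009_fourArm_lowerBound`. The discharge `Nolin2008_cor41_holds` is this theorem applied to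
their `_holds`. [cite: Nolin2008, §7.4, Cor. 41 (arXiv 0711.4948: Cor. 39)] [cite: WernerPCMI2009, Lecture 6, Lemma 6.2 and Cor. 6.3] -/
theorem Nolin2008_cor41_of_lemma62 (h62 : Werner2009_lemma62) (hQM : Werner2009_fourArm_quasiMult)
    (hLB : Werner2009_fourArm_lowerBound) : Nolin2008_cor41 :=
  Nolin2008_cor41_of_scaling (Nolin2008_prop34_of_expDecay BollobasRiordan2006_tri_expDecay_holds h62)
    hQM hLB

/-! ### `θ(p) ≍ π₁(L_ε(p))` for every `ε` without the RSW clause -/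

/-- **`θ(p) ≍ π₁(L_ε(p))` for every `ε ∈ (0, 1/2)`** (Nolin 2008, §7.4, eq. (7.25)) from the five
near-critical arm estimates of `Nolin2008_theta_asymp_of_facts` (`KestenScalingThetaProofs.lean`)
and Kesten's relation `Nolin2008_prop34` — `Nolin2008_theta_asymp_of_prop34`
(`CharLengthEquivalence.lean`) without its hypothesis `Nolin2008_RSW_one`. [cite: Nolin2008, §7.4, eq. (7.25) (arXiv 0711.4948: display after Cor. 39)] -/
theorem Nolin2008_theta_asymp_of_scaling (hQM : Werner2009_fourArm_quasiMult)
    (hLB : Werner2009_fourArm_lowerBound) (hHP : Nolin2008_halfPlane_twoArm)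
    (hHP' : Werner2009_halfPlane_twoArm) (hP : Werner2009_pivotal_lowerBound)
    (hK : Nolin2008_prop34) : Nolin2008_theta_asymp :=
  Nolin2008_theta_asymp_of_facts hQM hLB hHP hHP' hP (Nolin2008_cor41_of_scaling hK hQM hLB)

/-- **`θ(p) ≍ π₁(L_ε(p))` for every `ε ∈ (0, 1/2)` from six leaves**: the five near-critical arm
estimates and the pivotal count `Werner2009_lemma62` — `Nolin2008_theta_asymp_of_lemma62` without
`Nolin2008_RSW_one`. [cite: Nolin2008, §7.4, eq. (7.25) (arXiv 0711.4948: display after Cor. 39)] [cite: WernerPCMI2009, Lecture 6, Lemma 6.2] -/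
theorem Nolin2008_theta_asymp_of_leaves₆ (hQM : Werner2009_fourArm_quasiMult)
    (hLB : Werner2009_fourArm_lowerBound) (hHP : Nolin2008_halfPlane_twoArm)
    (hHP' : Werner2009_halfPlane_twoArm) (hP : Werner2009_pivotal_lowerBound)
    (h62 : Werner2009_lemma62) : Nolin2008_theta_asymp :=
  Nolin2008_theta_asymp_of_scaling hQM hLB hHP hHP' hP
    (Nolin2008_prop34_of_expDecay BollobasRiordan2006_tri_expDecay_holds h62)

/-! ### crit-perc.S16 from four named facts -/

/-- **crit-perc.S16 from Kesten's relation and three further named facts.**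
`θ(p) = (p - 1/2)^{5/36 + o(1)}` as `p ↓ 1/2` (Smirnov–Werner 2001, Thm. 1 (i); Kesten 1987;
Werner 2009, Thm. 6.1) follows from the critical arm exponents `oneArm_exponent` (`5/48`) and
`fourArm_exponent` (`5/4`), Kesten's relation `Nolin2008_prop34` and the near-critical stability of
one arm `Nolin2008_thm27_oneArm`, at the single value `ε = min ε₀ (1/4)` with the `ε₀` of
`Nolin2008_lemma39_small_holds`: Cor. 41 at `ε` is `Nolin2008_cor41_at_of_ladder` with the
unconditional decay, then `Nolin2008_theta_asymp_at_of_nearCritical` and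
`triTheta_exponent_of_scaling_at`. [cite: SmirnovWernerMRL2001, §2, Thm. 1 (i) and the paragraph following it] [cite: Nolin2008, §7.4, eq. (7.25) and the two displays after it] -/
theorem triTheta_exponent_of_prop34 (h₁ : oneArm_exponent) (h₄ : fourArm_exponent)
    (hK : Nolin2008_prop34) (h27 : Nolin2008_thm27_oneArm) : triTheta_exponent := by
  obtain ⟨ε₀, hε₀, h39⟩ := Nolin2008_lemma39_small_holds
  have hε : 0 < min ε₀ (1 / 4) := lt_min hε₀ (by norm_num)
  have hε' : min ε₀ (1 / 4) < 1 / 2 := (min_le_right _ _).trans_lt (by norm_num)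
  have hεle : min ε₀ (1 / 4) ≤ ε₀ := min_le_left _ _
  have hcor := Nolin2008_cor41_at_of_ladder hε hε' tri_rsw_half_holds (h39 hε hεle 4 (by norm_num))
    (h39 hε hεle 2 (by norm_num)) Nolin2008_subcritical_crossing_holds
  exact triTheta_exponent_of_scaling_at h₁ h₄ (hK hε hε')
    (Nolin2008_theta_asymp_at_of_nearCritical (h27 hε hε') hcor)

/-- **crit-perc.S16 from four named facts of the tree**: `θ(p) = (p - 1/2)^{5/36 + o(1)}` as
`p ↓ 1/2` from `oneArm_exponent` (Lawler–Schramm–Werner 2002), `fourArm_exponent` (Smirnov–Werner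
2001), the pivotal count below `L(p)` `Werner2009_lemma62` (Werner 2009, Lemma 6.2; whence Kesten's
relation, `Nolin2008_prop34_of_expDecay` with the proved `BollobasRiordan2006_tri_expDecay_holds`)
and the near-critical one-arm stability `Nolin2008_thm27_oneArm` (Nolin 2008, Thm. 27; Kesten
1987) — the tree's `triTheta_exponent_of_leaves5` (`NearCriticalRSW.lean`) with its fifth leaf, the
RSW clause `Nolin2008_RSW_one`, removed by `Nolin2008_lemma39_at_holds_small`. Self-duality, RSW at
`1/2`, Russo's formula, the sub-critical exponential decay, the block argument and its start, the
ladder and the exponent bookkeeping are all proved in the tree. [cite: SmirnovWernerMRL2001, §2, Thm. 1 (i) and the paragraph following it] [cite: WernerPCMI2009, Lecture 6, Thm. 6.1 and "End of the proof of the theorem"] [cite: Nolin2008, §7.4] -/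
theorem triTheta_exponent_of_leaves4 (h₁ : oneArm_exponent) (h₄ : fourArm_exponent)
    (h62 : Werner2009_lemma62) (h27 : Nolin2008_thm27_oneArm) : triTheta_exponent :=
  triTheta_exponent_of_prop34 h₁ h₄
    (Nolin2008_prop34_of_expDecay BollobasRiordan2006_tri_expDecay_holds h62) h27

end Literature.Probability.Percolation
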